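import Literature.RingTheory.LocalCohomology.CechLowDegrees
import Literature.RingTheory.LocalCohomology.CechTorsion
import Literature.RingTheory.LocalCohomology.CechDepth
import Literature.RingTheory.LocalCohomology.CechFiniteness
import HarnessLib

/-!
# Twisted Čech differentials: the complex of an invertible sheaf given by a unit cocycle

Topic `Literature/RingTheory/LocalCohomology`. For an `R`-algebra `A`, `y_1, …, y_s ∈ R` and a
family `u_{ij} ∈ A_{y_i y_j}` (all ordered pairs — a `1`-cochain `u ∈ Č¹(y; A)`), the first two
differentials of the Čech complex of the invertible sheaf on `⋃ D(y_i)` with transition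
functions `u` (trivial on each `D(y_i)`), in the trivialisations (SGA 2 XI §1):

* `twD0 u : Č⁰ → Č¹`, `(d c)_{ij} = u_{ij} c_j - c_i`;
* `twD1 u : Č¹ → Č²`, `(d e)_{ijk} = u_{ij} e_{jk} - e_{ik} + e_{ij}`;
* `twZ1 u = ker twD1`, `twB1 u = im twD0` (inside `twZ1`), `twH2 u = twZ1 / twB1` — the first
  cohomology of the invertible sheaf (position `2` in the extended-complex numbering of
  `CechFiniteness.H2`);

with `twD1 ∘ twD0 = 0` when `u` is a cocycle (`twD1_twD0`), naturality along algebra maps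
(`cechObjMap_twD0`, `cechObjMap_twD1`) and along linear maps semilinear over an algebra map
(`cechObjMap_twD0_of_semilinear`, `cechObjMap_twD1_of_semilinear`, for the maps
"multiplication by `t^n`" between levels of an adic tower). Sections `Γ = ker twD0`.

Everything is proved; the definitions are `twD0`, `twD1`, `twZ1`, `twB1`, `twH2`.

## References

* [Grothendieck1968SGA2] A. Grothendieck, SGA 2, Exp. XI §1 (arXiv:math/0511279, p. 68).
* [StacksProject] The Stacks Project, Tag 01FG.
-/

noncomputable section

universe u

namespace Literature.RingTheory.LocalCohomology

variable {R : Type u} [CommRing R] {s : ℕ} {y : Fin s → R}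
variable {A : Type u} [CommRing A] [Algebra R A]

/-! ## Scalars and products in the localisations of an algebra -/

/-- Scalars pass through products: `r • (X Z) = X (r • Z)`. [folklore] -/
theorem smul_mul_eq_mul_smul' {n : ℕ} (τ : Fin n → Fin s) (r : R) (X Z : CechLoc y A τ) :
    r • (X * Z) = X * (r • Z) := by
  induction X using LocalizedModule.induction_on with | h a p => ?_
  induction Z using LocalizedModule.induction_on with | h b q => ?_
  rw [LocalizedModule.mk_mul_mk, LocalizedModule.smul'_mk, LocalizedModule.smul'_mk,
    LocalizedModule.mk_mul_mk, mul_smul_comm]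

/-- Naturality of `res` in the module, elementwise. [folklore] -/
theorem res_locMap_apply' {M N : Type u} [AddCommGroup M] [Module R M] [AddCommGroup N] [Module R N]
    (ψ : M →ₗ[R] N) {n n' : ℕ} (τ : Fin n → Fin s) (θ : Fin n' → Fin n) (X : CechLoc y M (τ ∘ θ)) :
    res y N τ θ (locMap y ψ (τ ∘ θ) X) = locMap y ψ τ (res y M τ θ X) := by
  have h := congrArg (fun f => f X) (res_comp_locMap y ψ τ θ)
  simpa using h

/-! ## The twisted differentials -/

/-- **`d⁰` of the invertible sheaf with transition functions `u`**: `(d c)_{ij} = u_{ij} c_j - c_i`.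
[cite: Grothendieck1968SGA2, Exp. XI §1] -/
def twD0 (u : CechObj y A 1) : CechObj y A 0 →ₗ[R] CechObj y A 1 where
  toFun c τ := u τ * res y A τ (Fin.succAbove 0) (c (τ ∘ Fin.succAbove 0)) -
    res y A τ (Fin.succAbove 1) (c (τ ∘ Fin.succAbove 1))
  map_add' c c' := funext fun τ => by
    simp only [Pi.add_apply, map_add]; ring
  map_smul' r c := funext fun τ => by
    simp only [Pi.smul_apply, LinearMap.map_smul, RingHom.id_apply, smul_sub, smul_mul_eq_mul_smul']

/-- `twD0` componentwise. [folklore] -/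
@[simp] theorem twD0_apply (u : CechObj y A 1) (c : CechObj y A 0) (τ : Fin 2 → Fin s) :
    twD0 u c τ = u τ * res y A τ (Fin.succAbove 0) (c (τ ∘ Fin.succAbove 0)) -
      res y A τ (Fin.succAbove 1) (c (τ ∘ Fin.succAbove 1)) := rfl

/-- **`d¹` of the invertible sheaf with transition functions `u`**:
`(d e)_{ijk} = u_{ij} e_{jk} - e_{ik} + e_{ij}`. [cite: Grothendieck1968SGA2, Exp. XI §1] -/
def twD1 (u : CechObj y A 1) : CechObj y A 1 →ₗ[R] CechObj y A 2 where
  toFun e σ := res y A σ (Fin.succAbove 2) (u (σ ∘ Fin.succAbove 2)) *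
      res y A σ (Fin.succAbove 0) (e (σ ∘ Fin.succAbove 0)) -
    res y A σ (Fin.succAbove 1) (e (σ ∘ Fin.succAbove 1)) +
    res y A σ (Fin.succAbove 2) (e (σ ∘ Fin.succAbove 2))
  map_add' e e' := funext fun σ => by
    simp only [Pi.add_apply, map_add]; ring
  map_smul' r e := funext fun σ => by
    simp only [Pi.smul_apply, LinearMap.map_smul, RingHom.id_apply, smul_sub, smul_add,
      smul_mul_eq_mul_smul']

/-- `twD1` componentwise. [folklore] -/
@[simp] theorem twD1_apply (u : CechObj y A 1) (e : CechObj y A 1) (σ : Fin 3 → Fin s) :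
    twD1 u e σ = res y A σ (Fin.succAbove 2) (u (σ ∘ Fin.succAbove 2)) *
        res y A σ (Fin.succAbove 0) (e (σ ∘ Fin.succAbove 0)) -
      res y A σ (Fin.succAbove 1) (e (σ ∘ Fin.succAbove 1)) +
      res y A σ (Fin.succAbove 2) (e (σ ∘ Fin.succAbove 2)) := rfl

/-- The twisted `1`-cocycles `Z¹ = ker d¹`. [folklore] -/
abbrev twZ1 (u : CechObj y A 1) : Submodule R (CechObj y A 1) := LinearMap.ker (twD1 u)

/-- The twisted `1`-coboundaries `B¹ = im d⁰`, as a submodule of `Z¹`. [folklore] -/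
abbrev twB1 (u : CechObj y A 1) : Submodule R (twZ1 u) := (LinearMap.range (twD0 u)).comap (twZ1 u).subtype

/-- **The first cohomology of the invertible sheaf** with transition functions `u`
(`H¹(⋃ D(y_i), ℒ_u) = Z¹/B¹`; position `2` in the extended-complex numbering). [folklore] -/
abbrev twH2 (u : CechObj y A 1) : Type u := (twZ1 u) ⧸ twB1 u

/-! ## Faces of triples as singletons -/

/-- Double restriction of a `0`-cochain equals the direct restriction along the composite face
map. [folklore] -/
theorem res_res_apply_eq_resOf_zero (M : Type u) [AddCommGroup M] [Module R M] (c : CechObj y M 0)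
    {n m : ℕ} (t : Fin n → Fin s) (θ : Fin m → Fin n) (θ' : Fin 1 → Fin m) (κ : Fin 1 → Fin n)
    (e : θ ∘ θ' = κ) :
    res y M t θ (res y M (t ∘ θ) θ' (c ((t ∘ θ) ∘ θ'))) =
      resOf y M (t ∘ κ) t (dvd_comp y t κ) (c (t ∘ κ)) := by
  have h1 := congrArg (fun f => f (c ((t ∘ θ) ∘ θ'))) (res_comp y M t θ θ')
  simp only [LinearMap.coe_comp, Function.comp_apply] at h1
  rw [h1, res_eq_resOf' y M t (θ ∘ θ') (dvd_comp y t (θ ∘ θ'))]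
  exact resOf_apply_congr c (show t ∘ (θ ∘ θ') = t ∘ κ by rw [e]) t _ _

/-- The six composites `δ_i ∘ δ_a : [0] → [2]`. [folklore] -/
theorem succAbove_comp_succAbove_fin_three :
    (Fin.succAbove (0 : Fin 3) ∘ Fin.succAbove (0 : Fin 2) = ![2]) ∧
    (Fin.succAbove (0 : Fin 3) ∘ Fin.succAbove (1 : Fin 2) = ![1]) ∧
    (Fin.succAbove (1 : Fin 3) ∘ Fin.succAbove (0 : Fin 2) = ![2]) ∧
    (Fin.succAbove (1 : Fin 3) ∘ Fin.succAbove (1 : Fin 2) = ![0]) ∧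
    (Fin.succAbove (2 : Fin 3) ∘ Fin.succAbove (0 : Fin 2) = ![1]) ∧
    (Fin.succAbove (2 : Fin 3) ∘ Fin.succAbove (1 : Fin 2) = ![0]) := by
  refine ⟨?_, ?_, ?_, ?_, ?_, ?_⟩ <;> (funext k; fin_cases k; rfl)

/-! ## `d¹ ∘ d⁰ = 0` -/

/-- **`d¹ ∘ d⁰ = 0` for a cocycle `u`** (`u_{ij} u_{jk} = u_{ik}`). [folklore] -/
theorem twD1_twD0 (u : CechObj y A 1)
    (hcoc : ∀ σ : Fin 3 → Fin s,
      res y A σ (Fin.succAbove 2) (u (σ ∘ Fin.succAbove 2)) *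
        res y A σ (Fin.succAbove 0) (u (σ ∘ Fin.succAbove 0)) =
      res y A σ (Fin.succAbove 1) (u (σ ∘ Fin.succAbove 1)))
    (c : CechObj y A 0) : twD1 u (twD0 u c) = 0 := by
  funext σ
  obtain ⟨e00, e01, e10, e11, e20, e21⟩ := succAbove_comp_succAbove_fin_three
  rw [twD1_apply, Pi.zero_apply, twD0_apply, twD0_apply, twD0_apply]
  simp only [map_sub, res_mul]
  rw [res_res_apply_eq_resOf_zero A c σ _ _ _ e00, res_res_apply_eq_resOf_zero A c σ _ _ _ e01,
    res_res_apply_eq_resOf_zero A c σ _ _ _ e10, res_res_apply_eq_resOf_zero A c σ _ _ _ e11,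
    res_res_apply_eq_resOf_zero A c σ _ _ _ e20, res_res_apply_eq_resOf_zero A c σ _ _ _ e21,
    ← hcoc σ]
  ring

/-! ## Naturality -/

section Naturality

variable {A' : Type u} [CommRing A'] [Algebra R A'] (φ : A →ₐ[R] A')

/-- `d⁰` is natural along algebra maps. [folklore] -/
theorem cechObjMap_twD0 (u : CechObj y A 1) (c : CechObj y A 0) :
    cechObjMap y φ.toLinearMap 1 (twD0 u c) = twD0 (cechObjMap y φ.toLinearMap 1 u)
      (cechObjMap y φ.toLinearMap 0 c) := by
  funext τ
  simp only [cechObjMap_apply, twD0_apply, map_sub, locMap_mul, res_locMap_apply']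

/-- `d¹` is natural along algebra maps. [folklore] -/
theorem cechObjMap_twD1 (u : CechObj y A 1) (e : CechObj y A 1) :
    cechObjMap y φ.toLinearMap 2 (twD1 u e) = twD1 (cechObjMap y φ.toLinearMap 1 u)
      (cechObjMap y φ.toLinearMap 1 e) := by
  funext σ
  simp only [cechObjMap_apply, twD1_apply, map_sub, map_add, locMap_mul, res_locMap_apply']

variable (ψ : A' →ₗ[R] A) (hψ : ∀ (x : A) (a' : A'), ψ (φ x * a') = x * ψ a')

/-- **`d⁰` along a semilinear map** ("multiplication by `t^n`"): if `ψ (φ x · a') = x · ψ a'`,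
then `ψ (d⁰_{φ u} c') = d⁰_u (ψ c')`. [folklore] -/
theorem cechObjMap_twD0_of_semilinear (hψ : ∀ (x : A) (a' : A'), ψ (φ x * a') = x * ψ a')
    (u : CechObj y A 1) (c' : CechObj y A' 0) :
    cechObjMap y ψ 1 (twD0 (cechObjMap y φ.toLinearMap 1 u) c') = twD0 u (cechObjMap y ψ 0 c') := by
  funext τ
  simp only [cechObjMap_apply, twD0_apply, map_sub, res_locMap_apply']
  rw [locMap_mul_locMap_of_semilinear y φ ψ hψ]

/-- **`d¹` along a semilinear map.** [folklore] -/
theorem cechObjMap_twD1_of_semilinear (hψ : ∀ (x : A) (a' : A'), ψ (φ x * a') = x * ψ a')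
    (u : CechObj y A 1) (e' : CechObj y A' 1) :
    cechObjMap y ψ 2 (twD1 (cechObjMap y φ.toLinearMap 1 u) e') = twD1 u (cechObjMap y ψ 1 e') := by
  funext σ
  simp only [cechObjMap_apply, twD1_apply, map_sub, map_add, res_locMap_apply']
  rw [locMap_mul_locMap_of_semilinear y φ ψ hψ]

end Naturality

end Literature.RingTheory.LocalCohomology

end
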